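import Summits.Ventures.PercRepro.RankLevelSet

/-!
# PercRepro — C-025 «RANK LEVEL-SET INEQUALITY»: Theorem M, the extremal size `|E| = p + q` (p3, gen 6)

`C025` (typer-2 `RankLevelSet.lean`): `Φ(p,q)·|U(p,q)| ≤ |Y(p,q)|` with `U(p,q) = {A ⊆ E : r(A) = p, r(E ∖ A) = q}`,
`Y(p,q) = {A ⊆ E : q < r(A) < p}`, `Φ = phiK`; its LEVEL-WISE form (R1) is `C(p+q,p)·W_u ≥ C(p+q,u)·|U(p,q)|`
with `W_u = #{S ⊆ E : r(S) = u}`. Mine-2's Theorem M (`proofs/MINE2-RLS.md` §12): both hold when `|E| = p + q`.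

* `indepSets M u` — the independent `u`-subsets of `E` (a `Finset` of `Finset`s), `i_u := (indepSets M u).card`;
* `card_indepSets_succ_mul_le` — THE HEREDITARY BOUND `(u+1)·i_{u+1} ≤ (|E|−u)·i_u`
  (`Finset.card_mul_le_card_mul`: every independent `(u+1)`-set has `u+1` independent `u`-subsets, every
  independent `u`-set has at most `|E| − u` independent one-point extensions);
* `choose_mul_card_indepSets_le` — `C(|E|,u)·i_p ≤ C(|E|,p)·i_u` for `u ≤ p ≤ |E|` (the ratio `i_u/C(|E|,u)`
  is non-increasing; iterate through `Nat.choose_succ_right_eq`);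
* `card_indepSets_le_ncard_rank` — `i_u ≤ W_u`; `ncard_U_le_card_indepSets` — at `|E| = p + q` every member of
  `U(p,q)` is an independent `p`-set, so `|U| ≤ i_p`;
* **`c025_levelwise_of_ncard_eq`** — `|E| = p + q`, `u ≤ p` ⇒ `C(p+q,u)·|U(p,q)| ≤ C(p+q,p)·W_u` (in `ℕ`);
* **`c025_of_ncard_eq`** — `|E| = p + q` ⇒ the `C025` body for `(p, q)` (every `p, q`), via
  `sum_card_indepSets_le_ncard_Y` (`Σ_{q<u<p} i_u ≤ |Y(p,q)|`).
The set-builders are byte-identical to the body of `C025`. Axioms: standard.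
-/

namespace PercRepro

open Set Matroid Finset

variable {α : Type} (M : Matroid α) [M.Finite]

/-- The independent `u`-subsets of the ground set, as a `Finset` of `Finset`s. -/
noncomputable def indepSets (u : ℕ) : Finset (Finset α) := by
  classical
  exact ((M.set_finite M.E).toFinset.powersetCard u).filter (fun s => M.Indep (s : Set α))

/-- Membership in `indepSets M u`: a subset of `E` of size `u` that is independent. -/
lemma mem_indepSets {u : ℕ} {s : Finset α} :
    s ∈ indepSets M u ↔ s ⊆ (M.set_finite M.E).toFinset ∧ s.card = u ∧ M.Indep (s : Set α) := by
  classical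
  unfold indepSets
  rw [Finset.mem_filter, Finset.mem_powersetCard]
  tauto

/-- **The hereditary bound** `(u+1)·i_{u+1} ≤ (|E|−u)·i_u` for the counts of independent sets (double
counting the pairs `I ⊂ I'` of independent sets of sizes `u`, `u+1`). -/
lemma card_indepSets_succ_mul_le (u : ℕ) :
    (indepSets M (u + 1)).card * (u + 1) ≤ (indepSets M u).card * (M.E.ncard - u) := by
  classical
  set Ef := (M.set_finite M.E).toFinset with hEf
  have hEcard : Ef.card = M.E.ncard := (ncard_eq_toFinset_card _ (M.set_finite M.E)).symm
  refine Finset.card_mul_le_card_mul (fun (I' I : Finset α) => I ⊆ I') ?_ ?_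
  · intro I' hI'
    rw [mem_indepSets M] at hI'
    obtain ⟨hI'E, hI'card, hI'ind⟩ := hI'
    calc u + 1 = (I'.powersetCard u).card := by rw [Finset.card_powersetCard, hI'card, Nat.choose_succ_self_right]
      _ ≤ ((indepSets M u).bipartiteAbove (fun (I' I : Finset α) => I ⊆ I') I').card := by
          apply Finset.card_le_card
          intro I hI
          rw [Finset.mem_powersetCard] at hI
          rw [Finset.mem_bipartiteAbove, mem_indepSets M]
          refine ⟨⟨hI.1.trans hI'E, hI.2, hI'ind.subset (by exact_mod_cast hI.1)⟩, hI.1⟩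
  · intro I hI
    rw [mem_indepSets M] at hI
    obtain ⟨hIE, hIcard, -⟩ := hI
    calc ((indepSets M (u + 1)).bipartiteBelow (fun (I' I : Finset α) => I ⊆ I') I).card
        ≤ ((Ef \ I).image (fun x => insert x I)).card := by
          apply Finset.card_le_card
          intro I' hI'
          rw [Finset.mem_bipartiteBelow, mem_indepSets M] at hI'
          obtain ⟨⟨hI'E, hI'card, -⟩, hII'⟩ := hI'
          rw [Finset.mem_image]
          have hsd : (I' \ I).card = 1 := by
            rw [Finset.card_sdiff_of_subset hII', hI'card, hIcard]; omega
          obtain ⟨x, hx⟩ := Finset.card_eq_one.1 hsd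
          refine ⟨x, ?_, ?_⟩
          · have hxI' : x ∈ I' \ I := by rw [hx]; exact Finset.mem_singleton_self x
            rw [Finset.mem_sdiff] at hxI' ⊢
            exact ⟨hI'E hxI'.1, hxI'.2⟩
          · have h1 : insert x I = I' \ I ∪ I := by rw [hx, Finset.singleton_union]
            rw [h1, Finset.sdiff_union_of_subset hII']
      _ ≤ (Ef \ I).card := Finset.card_image_le
      _ = M.E.ncard - u := by rw [Finset.card_sdiff_of_subset hIE, hEcard, hIcard]

/-- `C(n,u)·i_p ≤ C(n,p)·i_u` for `u ≤ p ≤ n = |E|`: the ratio `i_u / C(n,u)` is non-increasing in `u`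
(iterate the hereditary bound through `Nat.choose_succ_right_eq`). -/
lemma choose_mul_card_indepSets_le {u : ℕ} :
    ∀ p, u ≤ p → p ≤ M.E.ncard →
      M.E.ncard.choose u * (indepSets M p).card ≤ M.E.ncard.choose p * (indepSets M u).card := by
  intro p hup
  induction p, hup using Nat.le_induction with
  | base => intro _; exact le_of_eq (by ring)
  | succ p hup ih =>
    intro hpn
    have ih' := ih (by omega)
    have hstep := card_indepSets_succ_mul_le M p
    have hchoose : M.E.ncard.choose (p + 1) * (p + 1) = M.E.ncard.choose p * (M.E.ncard - p) :=
      Nat.choose_succ_right_eq _ _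
    refine Nat.le_of_mul_le_mul_right ?_ (Nat.succ_pos p)
    calc M.E.ncard.choose u * (indepSets M (p + 1)).card * (p + 1)
        = M.E.ncard.choose u * ((indepSets M (p + 1)).card * (p + 1)) := by ring
      _ ≤ M.E.ncard.choose u * ((indepSets M p).card * (M.E.ncard - p)) :=
          Nat.mul_le_mul_left _ hstep
      _ = (M.E.ncard.choose u * (indepSets M p).card) * (M.E.ncard - p) := by ring
      _ ≤ (M.E.ncard.choose p * (indepSets M u).card) * (M.E.ncard - p) :=
          Nat.mul_le_mul_right _ ih'
      _ = (M.E.ncard.choose p * (M.E.ncard - p)) * (indepSets M u).card := by ring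
      _ = M.E.ncard.choose (p + 1) * (indepSets M u).card * (p + 1) := by rw [← hchoose]; ring

/-- The independent `u`-subsets of `E` lie among the subsets of `E` of rank `u`. -/
lemma card_indepSets_le_ncard_rank (u : ℕ) :
    (indepSets M u).card ≤ {S : Set α | S ⊆ M.E ∧ M.eRk S = (u : ℕ∞)}.ncard := by
  classical
  have hfin : {S : Set α | S ⊆ M.E ∧ M.eRk S = (u : ℕ∞)}.Finite :=
    (M.set_finite M.E).finite_subsets.subset (fun S hS => hS.1)
  rw [← ncard_coe_finset]
  refine ncard_le_ncard_of_injOn (fun s => (s : Set α)) ?_ ?_ hfin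
  · intro s hs
    rw [Finset.mem_coe, mem_indepSets M] at hs
    obtain ⟨hsE, hscard, hsind⟩ := hs
    refine ⟨fun x hx => ?_, ?_⟩
    · have := hsE hx
      rwa [(M.set_finite M.E).mem_toFinset] at this
    · rw [hsind.eRk_eq_encard, encard_coe_eq_coe_finsetCard, hscard]
  · intro s _ s' _ hEq
    exact Finset.coe_injective hEq

/-- The independent `u`-subsets of `E` as a family of sets; its `ncard` is `(indepSets M u).card`. -/
lemma ncard_image_indepSets (u : ℕ) :
    ((fun s : Finset α => (s : Set α)) '' ↑(indepSets M u)).ncard = (indepSets M u).card := by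
  rw [ncard_image_of_injective _ Finset.coe_injective, ncard_coe_finset]

/-- At `|E| = p + q`, every member of `U(p,q)` is an independent `p`-subset of `E`: `#U ≤ i_p`. -/
lemma ncard_U_le_card_indepSets {p q : ℕ} (hE : M.E.ncard = p + q) :
    {A : Set α | A ⊆ M.E ∧ M.eRk A = (p : ℕ∞) ∧ M.eRk (M.E \ A) = (q : ℕ∞)}.ncard ≤
      (indepSets M p).card := by
  classical
  have hEfin : M.E.Finite := M.set_finite M.E
  rw [← ncard_image_indepSets M p]
  refine ncard_le_ncard ?_ ((Finset.finite_toSet _).image _)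
  rintro A ⟨hA, hpA, hqA⟩
  have hAfin : A.Finite := hEfin.subset hA
  have hcA : p ≤ A.ncard := by
    have h := hpA ▸ M.eRk_le_encard A
    rw [← hAfin.cast_ncard_eq] at h
    exact_mod_cast h
  have hcEA : q ≤ (M.E \ A).ncard := by
    have h := hqA ▸ M.eRk_le_encard (M.E \ A)
    rw [← (hEfin.subset sdiff_subset).cast_ncard_eq] at h
    exact_mod_cast h
  have hsum := ncard_sdiff_add_ncard_of_subset hA hEfin
  have hAcard : A.ncard = p := by omega
  have hind : M.Indep A := by
    rw [indep_iff_eRk_eq_encard_of_finite hAfin, hpA, ← hAfin.cast_ncard_eq, hAcard]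
  refine ⟨hAfin.toFinset, ?_, hAfin.coe_toFinset⟩
  rw [Finset.mem_coe, mem_indepSets M]
  refine ⟨?_, ?_, by rw [hAfin.coe_toFinset]; exact hind⟩
  · intro x hx
    rw [hAfin.mem_toFinset] at hx
    rw [hEfin.mem_toFinset]
    exact hA hx
  · rw [← ncard_eq_toFinset_card A hAfin, hAcard]

/-- **C-025, Theorem M, level-wise** (mine-2, MINE2-RLS.md §12): if `|E| = p + q` then for every `u ≤ p`,
`C(p+q, u)·#{A ⊆ E : r(A) = p, r(E ∖ A) = q} ≤ C(p+q, p)·#{S ⊆ E : r(S) = u}` — the (R1) form of the row. -/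
theorem c025_levelwise_of_ncard_eq (p q u : ℕ) (hE : M.E.ncard = p + q) (hup : u ≤ p) :
    (p + q).choose u *
      {A : Set α | A ⊆ M.E ∧ M.eRk A = (p : ℕ∞) ∧ M.eRk (M.E \ A) = (q : ℕ∞)}.ncard ≤
      (p + q).choose p * {S : Set α | S ⊆ M.E ∧ M.eRk S = (u : ℕ∞)}.ncard := by
  have h1 := ncard_U_le_card_indepSets M hE
  have h2 := choose_mul_card_indepSets_le M p hup (by omega)
  have h3 := card_indepSets_le_ncard_rank M u
  rw [hE] at h2
  calc (p + q).choose u *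
        {A : Set α | A ⊆ M.E ∧ M.eRk A = (p : ℕ∞) ∧ M.eRk (M.E \ A) = (q : ℕ∞)}.ncard
      ≤ (p + q).choose u * (indepSets M p).card := Nat.mul_le_mul_left _ h1
    _ ≤ (p + q).choose p * (indepSets M u).card := h2
    _ ≤ (p + q).choose p * {S : Set α | S ⊆ M.E ∧ M.eRk S = (u : ℕ∞)}.ncard :=
        Nat.mul_le_mul_left _ h3

/-- `Σ_{q<u<p} i_u ≤ |Y(p,q)|`: the independent sets of size strictly between `q` and `p` lie in `Y`. -/
lemma sum_card_indepSets_le_ncard_Y (p q : ℕ) :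
    ∑ u ∈ Finset.Ioo q p, (indepSets M u).card ≤
      {A : Set α | A ⊆ M.E ∧ (q : ℕ∞) < M.eRk A ∧ M.eRk A < (p : ℕ∞)}.ncard := by
  classical
  have hEfin : M.E.Finite := M.set_finite M.E
  set F : Finset (Finset α) := (Finset.Ioo q p).biUnion (fun u => indepSets M u) with hF
  have hFcard : F.card = ∑ u ∈ Finset.Ioo q p, (indepSets M u).card := by
    rw [hF, Finset.card_biUnion]
    intro u _ v _ huv
    change Disjoint _ _
    rw [Finset.disjoint_left]
    intro s hs hs'
    rw [mem_indepSets M] at hs hs'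
    exact huv (hs.2.1.symm.trans hs'.2.1)
  have hYfin : {A : Set α | A ⊆ M.E ∧ (q : ℕ∞) < M.eRk A ∧ M.eRk A < (p : ℕ∞)}.Finite :=
    hEfin.finite_subsets.subset (fun A hA => hA.1)
  have key : ((F : Set (Finset α))).ncard ≤
      {A : Set α | A ⊆ M.E ∧ (q : ℕ∞) < M.eRk A ∧ M.eRk A < (p : ℕ∞)}.ncard := by
    refine ncard_le_ncard_of_injOn (fun s => (s : Set α)) ?_ ?_ hYfin
    · intro s hs
      rw [Finset.mem_coe, hF, Finset.mem_biUnion] at hs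
      obtain ⟨u, hu, hs⟩ := hs
      rw [mem_indepSets M] at hs
      obtain ⟨hsE, hscard, hsind⟩ := hs
      rw [Finset.mem_Ioo] at hu
      have hrk : M.eRk (s : Set α) = (u : ℕ∞) := by
        rw [hsind.eRk_eq_encard, encard_coe_eq_coe_finsetCard, hscard]
      refine ⟨fun x hx => ?_, ?_, ?_⟩
      · have := hsE hx
        rwa [hEfin.mem_toFinset] at this
      · rw [hrk]; exact_mod_cast hu.1
      · rw [hrk]; exact_mod_cast hu.2
    · intro s _ s' _ hEq
      exact Finset.coe_injective hEq
  rw [ncard_coe_finset, hFcard] at key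
  exact key

/-- **C-025, Theorem M, sum form** (mine-2, MINE2-RLS.md §12): if `|E| = p + q` then
`Φ(p,q)·#{A ⊆ E : r(A) = p, r(E ∖ A) = q} ≤ #{A ⊆ E : q < r(A) < p}` — the `C025` body — for all `p, q`. -/
theorem c025_of_ncard_eq (p q : ℕ) (hE : M.E.ncard = p + q) :
    phiK p q * ({A : Set α | A ⊆ M.E ∧ M.eRk A = (p : ℕ∞) ∧ M.eRk (M.E \ A) = (q : ℕ∞)}.ncard : ℚ) ≤
      ({A : Set α | A ⊆ M.E ∧ (q : ℕ∞) < M.eRk A ∧ M.eRk A < (p : ℕ∞)}.ncard : ℚ) := by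
  have h1 := ncard_U_le_card_indepSets M hE
  have hY := sum_card_indepSets_le_ncard_Y M p q
  have hbin : (∑ u ∈ Finset.Ioo q p, (p + q).choose u) * (indepSets M p).card ≤
      (∑ u ∈ Finset.Ioo q p, (indepSets M u).card) * (p + q).choose p := by
    rw [Finset.sum_mul, Finset.sum_mul]
    refine Finset.sum_le_sum (fun u hu => ?_)
    rw [Finset.mem_Ioo] at hu
    have := choose_mul_card_indepSets_le M (u := u) p (by omega) (by omega)
    rw [hE] at this
    rw [mul_comm ((indepSets M u).card)]
    exact this
  have hchoose : (0 : ℚ) < ((p + q).choose p : ℚ) := by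
    exact_mod_cast Nat.choose_pos (by omega)
  have hphi : phiK p q * ((indepSets M p).card : ℚ) ≤
      ∑ u ∈ Finset.Ioo q p, ((indepSets M u).card : ℚ) := by
    unfold phiK
    rw [div_mul_eq_mul_div, div_le_iff₀ hchoose]
    exact_mod_cast hbin
  have hphi_nonneg : 0 ≤ phiK p q := by
    unfold phiK
    positivity
  calc phiK p q * ({A : Set α | A ⊆ M.E ∧ M.eRk A = (p : ℕ∞) ∧ M.eRk (M.E \ A) = (q : ℕ∞)}.ncard : ℚ)
      ≤ phiK p q * ((indepSets M p).card : ℚ) :=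
        mul_le_mul_of_nonneg_left (by exact_mod_cast h1) hphi_nonneg
    _ ≤ ∑ u ∈ Finset.Ioo q p, ((indepSets M u).card : ℚ) := hphi
    _ = ((∑ u ∈ Finset.Ioo q p, (indepSets M u).card : ℕ) : ℚ) := by push_cast; rfl
    _ ≤ ({A : Set α | A ⊆ M.E ∧ (q : ℕ∞) < M.eRk A ∧ M.eRk A < (p : ℕ∞)}.ncard : ℚ) := by
        exact_mod_cast hY

end PercRepro
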